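import Literature.NumberTheory.GaloisRepresentations.CrystallineOrdinaryShape

/-!
# drefute gen-3 probes for line `level-three-weierstrass-switch` (crux `StableYoshidaCongruence`):
# the Yoshida shape `(0,0,1,1)` of `IsGreenbergOrdinaryOfShape` / `IsResiduallyDistinguishedOfShape`
# unfolded into 2+2 block language (certified reading used in the stub-set attack on
# `stub_distinguishedTransferLocal` (1b) and `stub_tateModuleGreenberg` (3ii)).

Findings certified here (all sorry-free):
* `yoshida4Shape_ne_eq_iff` / `yoshida4Shape_lt_eq_iff`: the equal-weight index pairs of `![0,0,1,1]`.
* `FramedRep.isGreenbergOrdinaryOfShape_yoshida4_iff`: Greenberg-(0,0,1,1) ⟺ ∃ frame, upper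
  triangular on `Γ_K`, and on inertia: diagonal `(1, 1, ε⁻¹, ε⁻¹)` and the two WITHIN-block entries
  `M₀₁`, `M₂₃` vanish.  The four CROSS-block inertia entries `M₀₂, M₀₃, M₁₂, M₁₃` are UNCONSTRAINED —
  so the predicate does NOT ask the unramified-sub/`ε⁻¹`-quotient extension to split on inertia
  (which would have made stub 3ii false for every non-canonical ordinary abelian surface).
* `FramedRep.isResiduallyDistinguishedOfShape_yoshida4_iff`: distinguished-(0,0,1,1) ⟺ ∃ frame,
  triangular, inertial diagonal `(1,1,ε⁻¹,ε⁻¹)`, and ONE `τ ∈ Γ_K` with `‖M₀₀-M₁₁‖ = 1 ∧ ‖M₂₂-M₃₃‖ = 1`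
  (single-witness form, via the tree's `exists_norm_diagEntry_sub_eq_one_and`).
* global `…At v` versions through `toLocal v` (definitional).
-/

noncomputable section

open Field IsDedekindDomain
open scoped NumberField MatrixGroups

namespace Literature.NumberTheory.GaloisRepresentations

/-- The pairs `i ≠ j` of equal weight in the Yoshida shape `(0,0,1,1)` are `(0,1),(1,0),(2,3),(3,2)`. -/
theorem yoshida4Shape_ne_eq_iff (i j : Fin 4) :
    (i ≠ j ∧ (![0, 0, 1, 1] : Fin 4 → ℕ) i = ![0, 0, 1, 1] j) ↔
      i = 0 ∧ j = 1 ∨ i = 1 ∧ j = 0 ∨ i = 2 ∧ j = 3 ∨ i = 3 ∧ j = 2 := by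
  revert i j
  decide

/-- The pairs `i < j` of equal weight in the Yoshida shape `(0,0,1,1)` are `(0,1)` and `(2,3)`. -/
theorem yoshida4Shape_lt_eq_iff (i j : Fin 4) (hij : i < j) :
    (![0, 0, 1, 1] : Fin 4 → ℕ) i = ![0, 0, 1, 1] j ↔ i = 0 ∧ j = 1 ∨ i = 2 ∧ j = 3 := by
  revert i j
  decide

section Local

variable {K : Type} [Field K] [ValuativeRel K] [TopologicalSpace K] [IsNonarchimedeanLocalField K]
  {p : ℕ} [Fact p.Prime]

/-- **Greenberg-ordinary of shape `(0,0,1,1)`, unfolded.**  In some frame: upper triangular on all of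
`Γ_K`; on inertia the diagonal is `(1, 1, ε⁻¹, ε⁻¹)` and the within-block entries `(0,1)`, `(2,3)`
vanish.  Nothing is asked of the cross-block entries `(0,2),(0,3),(1,2),(1,3)`. -/
theorem FramedRep.isGreenbergOrdinaryOfShape_yoshida4_iff
    (ρ : FramedRep (absoluteGaloisGroup K) (PadicAlgCl p) 4) :
    ρ.IsGreenbergOrdinaryOfShape ![0, 0, 1, 1] ↔
      ∃ g : GL (Fin 4) (PadicAlgCl p),
        let M := fun τ =>
          ((g * ρ τ * g⁻¹ : GL (Fin 4) (PadicAlgCl p)) : Matrix (Fin 4) (Fin 4) (PadicAlgCl p));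
        (∀ τ (i j : Fin 4), j < i → M τ i j = 0) ∧
          ∀ τ ∈ absInertia K,
            M τ 0 0 = 1 ∧ M τ 1 1 = 1 ∧
            M τ 2 2 = algebraMap ℚ_[p] (PadicAlgCl p)
              ((((GaloisRep.cyclotomicCharacter K p τ)⁻¹ : ℤ_[p]ˣ) : ℤ_[p]) : ℚ_[p]) ∧
            M τ 3 3 = algebraMap ℚ_[p] (PadicAlgCl p)
              ((((GaloisRep.cyclotomicCharacter K p τ)⁻¹ : ℤ_[p]ˣ) : ℤ_[p]) : ℚ_[p]) ∧
            M τ 0 1 = 0 ∧ M τ 2 3 = 0 := by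
  refine exists_congr fun g => ?_
  dsimp only
  refine and_congr_right fun htri => ?_
  constructor
  · rintro ⟨hdiag, hblock⟩ τ hτ
    refine ⟨?_, ?_, ?_, ?_, hblock τ hτ 0 1 (by decide) (by decide),
      hblock τ hτ 2 3 (by decide) (by decide)⟩
    · simpa using hdiag τ hτ 0
    · simpa using hdiag τ hτ 1
    · simpa using hdiag τ hτ 2
    · simpa using hdiag τ hτ 3
  · intro h
    refine ⟨fun τ hτ i => ?_, fun τ hτ i j hij ha => ?_⟩
    · obtain ⟨h0, h1, h2, h3, -, -⟩ := h τ hτ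
      fin_cases i
      · simpa using h0
      · simpa using h1
      · simpa using h2
      · simpa using h3
    · obtain ⟨-, -, -, -, h01, h23⟩ := h τ hτ
      rcases (yoshida4Shape_ne_eq_iff i j).1 ⟨hij, ha⟩ with
        ⟨rfl, rfl⟩ | ⟨rfl, rfl⟩ | ⟨rfl, rfl⟩ | ⟨rfl, rfl⟩
      · exact h01
      · exact htri τ 1 0 (by decide)
      · exact h23
      · exact htri τ 3 2 (by decide)

/-- **Residually distinguished of shape `(0,0,1,1)`, unfolded (single-witness form).**  In some
frame: upper triangular on `Γ_K`, inertial diagonal `(1, 1, ε⁻¹, ε⁻¹)`, and ONE `τ ∈ Γ_K` with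
`‖M₀₀(τ) - M₁₁(τ)‖ = 1` and `‖M₂₂(τ) - M₃₃(τ)‖ = 1`. -/
theorem FramedRep.isResiduallyDistinguishedOfShape_yoshida4_iff
    (ρ : FramedRep (absoluteGaloisGroup K) (PadicAlgCl p) 4) :
    ρ.IsResiduallyDistinguishedOfShape ![0, 0, 1, 1] ↔
      ∃ g : GL (Fin 4) (PadicAlgCl p),
        let M := fun τ =>
          ((g * ρ τ * g⁻¹ : GL (Fin 4) (PadicAlgCl p)) : Matrix (Fin 4) (Fin 4) (PadicAlgCl p));
        (∀ τ (i j : Fin 4), j < i → M τ i j = 0) ∧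
          (∀ τ ∈ absInertia K,
            M τ 0 0 = 1 ∧ M τ 1 1 = 1 ∧
            M τ 2 2 = algebraMap ℚ_[p] (PadicAlgCl p)
              ((((GaloisRep.cyclotomicCharacter K p τ)⁻¹ : ℤ_[p]ˣ) : ℤ_[p]) : ℚ_[p]) ∧
            M τ 3 3 = algebraMap ℚ_[p] (PadicAlgCl p)
              ((((GaloisRep.cyclotomicCharacter K p τ)⁻¹ : ℤ_[p]ˣ) : ℤ_[p]) : ℚ_[p])) ∧
          ∃ τ, ‖M τ 0 0 - M τ 1 1‖ = 1 ∧ ‖M τ 2 2 - M τ 3 3‖ = 1 := by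
  haveI : CompactSpace (absoluteGaloisGroup K) := absoluteGaloisGroup_compactSpace K
  refine exists_congr fun g => ?_
  dsimp only
  refine and_congr_right fun htri => ?_
  have htri' : (ρ.conj g).IsUpperTriangular := htri
  refine and_congr ?_ ?_
  · constructor
    · intro hdiag τ hτ
      refine ⟨?_, ?_, ?_, ?_⟩
      · simpa using hdiag τ hτ 0
      · simpa using hdiag τ hτ 1
      · simpa using hdiag τ hτ 2
      · simpa using hdiag τ hτ 3
    · intro h τ hτ i
      obtain ⟨h0, h1, h2, h3⟩ := h τ hτ
      fin_cases i
      · simpa using h0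
      · simpa using h1
      · simpa using h2
      · simpa using h3
  · change (∀ i j : Fin 4, i < j → _ →
        ∃ τ, ‖(ρ.conj g).diagEntry i τ - (ρ.conj g).diagEntry j τ‖ = 1) ↔
      ∃ τ, ‖(ρ.conj g).diagEntry 0 τ - (ρ.conj g).diagEntry 1 τ‖ = 1 ∧
        ‖(ρ.conj g).diagEntry 2 τ - (ρ.conj g).diagEntry 3 τ‖ = 1
    constructor
    · intro h
      exact htri'.exists_norm_diagEntry_sub_eq_one_and (h 0 1 (by decide) (by decide))
        (h 2 3 (by decide) (by decide))
    · rintro ⟨τ, h01, h23⟩ i j hij hij'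
      rcases (yoshida4Shape_lt_eq_iff i j hij).1 hij' with ⟨rfl, rfl⟩ | ⟨rfl, rfl⟩
      exacts [⟨τ, h01⟩, ⟨τ, h23⟩]

end Local

section Global

variable {K : Type} [Field K] [NumberField K] {p : ℕ} [Fact p.Prime]

/-- Global form at a finite place `v` (through `toLocal v`, definitional). -/
theorem FramedGaloisRep.isGreenbergOrdinaryOfShapeAt_yoshida4_iff (v : HeightOneSpectrum (𝓞 K))
    (ρ : FramedGaloisRep K (PadicAlgCl p) 4) :
    ρ.IsGreenbergOrdinaryOfShapeAt v ![0, 0, 1, 1] ↔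
      ∃ g : GL (Fin 4) (PadicAlgCl p),
        let M := fun τ =>
          ((g * ρ.toLocal v τ * g⁻¹ : GL (Fin 4) (PadicAlgCl p)) :
            Matrix (Fin 4) (Fin 4) (PadicAlgCl p));
        (∀ τ (i j : Fin 4), j < i → M τ i j = 0) ∧
          ∀ τ ∈ absInertia (v.adicCompletion K),
            M τ 0 0 = 1 ∧ M τ 1 1 = 1 ∧
            M τ 2 2 = algebraMap ℚ_[p] (PadicAlgCl p)
              ((((GaloisRep.cyclotomicCharacter (v.adicCompletion K) p τ)⁻¹ : ℤ_[p]ˣ) : ℤ_[p]) :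
                ℚ_[p]) ∧
            M τ 3 3 = algebraMap ℚ_[p] (PadicAlgCl p)
              ((((GaloisRep.cyclotomicCharacter (v.adicCompletion K) p τ)⁻¹ : ℤ_[p]ˣ) : ℤ_[p]) :
                ℚ_[p]) ∧
            M τ 0 1 = 0 ∧ M τ 2 3 = 0 :=
  FramedRep.isGreenbergOrdinaryOfShape_yoshida4_iff (ρ.toLocal v)

/-- Global form at a finite place `v` (through `toLocal v`, definitional). -/
theorem FramedGaloisRep.isResiduallyDistinguishedAt_yoshida4_iff (v : HeightOneSpectrum (𝓞 K))
    (ρ : FramedGaloisRep K (PadicAlgCl p) 4) :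
    ρ.IsResiduallyDistinguishedAt v ![0, 0, 1, 1] ↔
      ∃ g : GL (Fin 4) (PadicAlgCl p),
        let M := fun τ =>
          ((g * ρ.toLocal v τ * g⁻¹ : GL (Fin 4) (PadicAlgCl p)) :
            Matrix (Fin 4) (Fin 4) (PadicAlgCl p));
        (∀ τ (i j : Fin 4), j < i → M τ i j = 0) ∧
          (∀ τ ∈ absInertia (v.adicCompletion K),
            M τ 0 0 = 1 ∧ M τ 1 1 = 1 ∧
            M τ 2 2 = algebraMap ℚ_[p] (PadicAlgCl p)
              ((((GaloisRep.cyclotomicCharacter (v.adicCompletion K) p τ)⁻¹ : ℤ_[p]ˣ) : ℤ_[p]) :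
                ℚ_[p]) ∧
            M τ 3 3 = algebraMap ℚ_[p] (PadicAlgCl p)
              ((((GaloisRep.cyclotomicCharacter (v.adicCompletion K) p τ)⁻¹ : ℤ_[p]ˣ) : ℤ_[p]) :
                ℚ_[p])) ∧
          ∃ τ, ‖M τ 0 0 - M τ 1 1‖ = 1 ∧ ‖M τ 2 2 - M τ 3 3‖ = 1 :=
  FramedRep.isResiduallyDistinguishedOfShape_yoshida4_iff (ρ.toLocal v)

end Global

end Literature.NumberTheory.GaloisRepresentations
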